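import Summits.ResolutionOfSingularities.ResolutionOfSingularities.Theorems.HomologicalConductorNoZenoSplitFieldFibre
import HarnessLib

/-!
# Crux `NoZenoR` / `NoZeno` (stmt-ResolutionOfSingularities-19943 / -16483), β2 descent, `stub_L1wCore` (F1) route,
# BC-2 algebra (assembly, II): the split weights in the fibre `Spec (K' ⊗_κ F)` add up to the split weight of `F`

OURS (cell res-hironaka, chain W4.4; stub worker res-L0-w44-stub-2 g12; brick DAG `L1W-PREP-v2.md` 95253e48ec58b05c
§2.1 D3/D5, brick BC-2).  Sequel to `…NoZenoSplitFieldFibre` (same setting and notation: `A = K' ⊗_κ F`,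
`M = K' ⊗_κ L`, `φ = id ⊗ (L → F)`, `L` finite separable over `κ` and separably closed in `F`); pure commutative
algebra over Mathlib; nothing here is a statement of the manuscript under review (Hironaka 2017); AI-written, weaker
than expert review.

* **`finrank_separableClosure_quotient_map_eq`** — the split weight of the fibre point `𝔪A` is `[M/𝔪 : K']`
  (`A/𝔪A` is a field generated over `F` by the image of `M/𝔪`; BC-2b (iii) `finrank_separableClosure_eq_of_adjoin_eq_top`);
* `finrank_separableClosure_residueField_eq_quotient` — `κ(p) ≃ A/p` over `K'`;
* **`finsum_finrank_separableClosure_residueField_eq`** — `Σ_{p ∈ Spec A} [κ(p)^s : K'] = [L : κ]` (with BC-2b (ii)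
  `finsum_finrank_quotient_maximalSpectrum_eq` along the bijection `MaxSpec M ≃ Spec A`), every weight `≥ 1`
  (`one_le_finrank_separableClosure_residueField`);
* the specialisations to the separable constant field `L = separableClosure κ F`:
  **`finsum_finrank_separableClosure_residueField_tensorProduct`** (`Σ_p [κ(p)^s : K'] = [κ^s ∩ F : κ]`),
  `one_le_finrank_separableClosure_residueField_tensorProduct` (for maximality of the primes and finiteness of the
  spectrum apply `isMaximal_of_isPrime` / `finite_primeSpectrum` with `separableClosure.separableClosure_eq_bot κ F`).
-/

noncomputable section

-- single-problem summit: the doubled namespace component `ResolutionOfSingularities` is forced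
set_option linter.dupNamespace false

namespace Summit.ResolutionOfSingularities.ResolutionOfSingularities.Theorems.NoZeno.ExcCount

open TensorProduct Polynomial IntermediateField

namespace SplitFieldFibre

-- Inside proofs, `F` acts on `K' ⊗[κ] F` and `L` on `K' ⊗[κ] L` through the RIGHT factor
-- (Mathlib's non-instance `Algebra.TensorProduct.rightAlgebra`, introduced with `letI`).

variable (κ K' F L : Type*) [Field κ] [Field K'] [Field F] [Field L] [Algebra κ K'] [Algebra κ F] [Algebra κ L]
  [Algebra L F] [IsScalarTower κ L F]

/-! ## The weights: `[(A/𝔪A)^s : K'] = [M/𝔪 : K']` -/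

section Weight

variable [Algebra.IsSeparable κ K'] [FiniteDimensional κ K'] [FiniteDimensional κ L] [Algebra.IsSeparable κ L]
  (h0 : separableClosure L F = ⊥) (𝔪 : Ideal (K' ⊗[κ] L)) [𝔪.IsMaximal]

include h0 in
/-- **The split weight of the fibre point `𝔪A` is `[M/𝔪 : K']`**: with `E := A/𝔪A` (a field, generated over `F`
by the image of the finite separable extension `M/𝔪` of `L`, `L` separably closed in `F`), BC-2b (iii)
`finrank_separableClosure_eq_of_adjoin_eq_top` gives `[E^s : K'] = [M/𝔪 : K']`. [this work] -/
theorem finrank_separableClosure_quotient_map_eq :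
    letI := Ideal.Quotient.field 𝔪
    haveI : (𝔪.map (Algebra.TensorProduct.map (AlgHom.id K' K') (IsScalarTower.toAlgHom κ L F))).IsMaximal := isMaximal_map κ K' F L h0 𝔪
    letI := Ideal.Quotient.field (𝔪.map (Algebra.TensorProduct.map (AlgHom.id K' K') (IsScalarTower.toAlgHom κ L F)))
    Module.finrank K' (separableClosure K' ((K' ⊗[κ] F) ⧸ 𝔪.map (Algebra.TensorProduct.map (AlgHom.id K' K') (IsScalarTower.toAlgHom κ L F)))) =
      Module.finrank K' ((K' ⊗[κ] L) ⧸ 𝔪) := by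
  letI := Ideal.Quotient.field 𝔪
  letI : Algebra L (K' ⊗[κ] L) := Algebra.TensorProduct.rightAlgebra
  letI : Algebra F (K' ⊗[κ] F) := Algebra.TensorProduct.rightAlgebra
  haveI hPmax : (𝔪.map (Algebra.TensorProduct.map (AlgHom.id K' K') (IsScalarTower.toAlgHom κ L F))).IsMaximal := isMaximal_map κ K' F L h0 𝔪
  letI := Ideal.Quotient.field (𝔪.map (Algebra.TensorProduct.map (AlgHom.id K' K') (IsScalarTower.toAlgHom κ L F)))
  -- `L` acts on `A = K' ⊗_κ F` (and on `A/𝔪A`) through `F`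
  letI : Algebra L (K' ⊗[κ] F) := ((algebraMap F (K' ⊗[κ] F)).comp (algebraMap L F)).toAlgebra
  haveI : IsScalarTower L F (K' ⊗[κ] F) := IsScalarTower.of_algebraMap_eq fun _ => rfl
  haveI : Module.Finite κ ((K' ⊗[κ] L) ⧸ 𝔪) := inferInstance
  haveI : Module.Finite L ((K' ⊗[κ] L) ⧸ 𝔪) := Module.Finite.of_restrictScalars_finite κ L _
  haveI : Algebra.IsSeparable κ ((K' ⊗[κ] L) ⧸ 𝔪) := isSeparable_quotient κ K' L 𝔪
  haveI : Algebra.IsSeparable L ((K' ⊗[κ] L) ⧸ 𝔪) := Algebra.isSeparable_tower_top_of_isSeparable κ L _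
  haveI : Algebra.IsSeparable K' ((K' ⊗[κ] L) ⧸ 𝔪) := Algebra.isSeparable_tower_top_of_isSeparable κ K' _
  -- `j₁ : M/𝔪 → A/𝔪A` induced by `φ`
  let ψ : (K' ⊗[κ] L) →+* (K' ⊗[κ] F) ⧸ 𝔪.map (Algebra.TensorProduct.map (AlgHom.id K' K') (IsScalarTower.toAlgHom κ L F)) := (Ideal.Quotient.mk (𝔪.map (Algebra.TensorProduct.map (AlgHom.id K' K') (IsScalarTower.toAlgHom κ L F)))).comp (Algebra.TensorProduct.map (AlgHom.id K' K') (IsScalarTower.toAlgHom κ L F)).toRingHom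
  have hψ𝔪 : ∀ m ∈ 𝔪, ψ m = 0 := fun m hm =>
    Ideal.Quotient.eq_zero_iff_mem.mpr (Ideal.mem_map_of_mem _ hm)
  let j₁ : ((K' ⊗[κ] L) ⧸ 𝔪) →+* (K' ⊗[κ] F) ⧸ 𝔪.map (Algebra.TensorProduct.map (AlgHom.id K' K') (IsScalarTower.toAlgHom κ L F)) := Ideal.Quotient.lift 𝔪 ψ hψ𝔪
  have hj₁ : ∀ m : K' ⊗[κ] L, j₁ (Ideal.Quotient.mk 𝔪 m) = Ideal.Quotient.mk (𝔪.map (Algebra.TensorProduct.map (AlgHom.id K' K') (IsScalarTower.toAlgHom κ L F))) ((Algebra.TensorProduct.map (AlgHom.id K' K') (IsScalarTower.toAlgHom κ L F)) m) :=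
    fun m => rfl
  letI : Algebra ((K' ⊗[κ] L) ⧸ 𝔪) ((K' ⊗[κ] F) ⧸ 𝔪.map (Algebra.TensorProduct.map (AlgHom.id K' K') (IsScalarTower.toAlgHom κ L F))) := j₁.toAlgebra
  haveI : IsScalarTower L ((K' ⊗[κ] L) ⧸ 𝔪) ((K' ⊗[κ] F) ⧸ 𝔪.map (Algebra.TensorProduct.map (AlgHom.id K' K') (IsScalarTower.toAlgHom κ L F))) :=
    IsScalarTower.of_algebraMap_eq fun ℓ => by
      change algebraMap L ((K' ⊗[κ] F) ⧸ 𝔪.map (Algebra.TensorProduct.map (AlgHom.id K' K') (IsScalarTower.toAlgHom κ L F))) ℓ = j₁ (algebraMap L ((K' ⊗[κ] L) ⧸ 𝔪) ℓ)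
      rw [IsScalarTower.algebraMap_apply L (K' ⊗[κ] L) ((K' ⊗[κ] L) ⧸ 𝔪), Ideal.Quotient.algebraMap_eq, hj₁,
        phi_algebraMap, IsScalarTower.algebraMap_apply L F ((K' ⊗[κ] F) ⧸ 𝔪.map (Algebra.TensorProduct.map (AlgHom.id K' K') (IsScalarTower.toAlgHom κ L F))),
        IsScalarTower.algebraMap_apply F (K' ⊗[κ] F) ((K' ⊗[κ] F) ⧸ 𝔪.map (Algebra.TensorProduct.map (AlgHom.id K' K') (IsScalarTower.toAlgHom κ L F))), Ideal.Quotient.algebraMap_eq]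
  haveI : IsScalarTower K' ((K' ⊗[κ] L) ⧸ 𝔪) ((K' ⊗[κ] F) ⧸ 𝔪.map (Algebra.TensorProduct.map (AlgHom.id K' K') (IsScalarTower.toAlgHom κ L F))) :=
    IsScalarTower.of_algebraMap_eq fun k => by
      change algebraMap K' ((K' ⊗[κ] F) ⧸ 𝔪.map (Algebra.TensorProduct.map (AlgHom.id K' K') (IsScalarTower.toAlgHom κ L F))) k = j₁ (algebraMap K' ((K' ⊗[κ] L) ⧸ 𝔪) k)
      rw [IsScalarTower.algebraMap_apply K' (K' ⊗[κ] L) ((K' ⊗[κ] L) ⧸ 𝔪), Ideal.Quotient.algebraMap_eq, hj₁,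
        phi_algebraMap_left, IsScalarTower.algebraMap_apply K' (K' ⊗[κ] F) ((K' ⊗[κ] F) ⧸ 𝔪.map (Algebra.TensorProduct.map (AlgHom.id K' K') (IsScalarTower.toAlgHom κ L F))),
        Ideal.Quotient.algebraMap_eq]
  -- `A/𝔪A` is generated over `F` by the image of `M/𝔪`
  have hgen : IntermediateField.adjoin F
      (Set.range (algebraMap ((K' ⊗[κ] L) ⧸ 𝔪) ((K' ⊗[κ] F) ⧸ 𝔪.map (Algebra.TensorProduct.map (AlgHom.id K' K') (IsScalarTower.toAlgHom κ L F))))) = ⊤ := by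
    rw [eq_top_iff]
    rintro y -
    apply IntermediateField.algebra_adjoin_le_adjoin
    obtain ⟨a, rfl⟩ := Ideal.Quotient.mk_surjective y
    induction a using TensorProduct.induction_on with
    | zero => rw [map_zero]; exact Subalgebra.zero_mem _
    | tmul k x =>
      rw [tmul_eq_algebraMap_mul κ K' F, map_mul]
      refine Subalgebra.mul_mem _
        (Algebra.subset_adjoin ⟨Ideal.Quotient.mk 𝔪 (algebraMap K' (K' ⊗[κ] L) k), ?_⟩) ?_
      · change j₁ _ = _
        rw [hj₁, phi_algebraMap_left]
      · rw [← Ideal.Quotient.algebraMap_eq, ← IsScalarTower.algebraMap_apply]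
        exact Subalgebra.algebraMap_mem _ x
    | add a a' ha ha' => rw [map_add]; exact Subalgebra.add_mem _ ha ha'
  exact finrank_separableClosure_eq_of_adjoin_eq_top (L := L) (F := F) (E := (K' ⊗[κ] F) ⧸ 𝔪.map (Algebra.TensorProduct.map (AlgHom.id K' K') (IsScalarTower.toAlgHom κ L F)))
    (L' := (K' ⊗[κ] L) ⧸ 𝔪) h0 hgen K'

end Weight

/-! ## The sum over the fibre -/

section Sum

variable [Algebra.IsSeparable κ K'] [FiniteDimensional κ K'] [FiniteDimensional κ L] [Algebra.IsSeparable κ L]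
  (h0 : separableClosure L F = ⊥)

include h0 in
/-- The weight at a (maximal) prime `p` of `A` through the residue field: `κ(p) ≃ A/p` over `K'`. [folklore] -/
theorem finrank_separableClosure_residueField_eq_quotient (p : PrimeSpectrum (K' ⊗[κ] F)) :
    haveI : p.asIdeal.IsMaximal := isMaximal_of_isPrime κ K' F L h0 p.asIdeal
    letI := Ideal.Quotient.field p.asIdeal
    Module.finrank K' (separableClosure K' p.asIdeal.ResidueField) =
      Module.finrank K' (separableClosure K' ((K' ⊗[κ] F) ⧸ p.asIdeal)) := by
  haveI : p.asIdeal.IsMaximal := isMaximal_of_isPrime κ K' F L h0 p.asIdeal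
  letI := Ideal.Quotient.field p.asIdeal
  let e : ((K' ⊗[κ] F) ⧸ p.asIdeal) ≃ₐ[K'] p.asIdeal.ResidueField :=
    AlgEquiv.ofBijective (IsScalarTower.toAlgHom K' ((K' ⊗[κ] F) ⧸ p.asIdeal) p.asIdeal.ResidueField)
      p.asIdeal.bijective_algebraMap_quotient_residueField
  exact (separableClosure.algEquivOfAlgEquiv e).toLinearEquiv.finrank_eq.symm

include h0 in
/-- **BC-2 (algebra): the split weights of the fibre add up to `[L : κ]`** — for `K'/κ` finite separable and
`L ⊆ F` finite separable over `κ` and separably closed in `F`: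
`Σ_{p ∈ Spec (K' ⊗_κ F)} [κ(p)^s : K'] = [L : κ]`. [this work] -/
theorem finsum_finrank_separableClosure_residueField_eq :
    ∑ᶠ p : PrimeSpectrum (K' ⊗[κ] F), Module.finrank K' (separableClosure K' p.asIdeal.ResidueField) =
      Module.finrank κ L := by
  rw [← finsum_finrank_quotient_maximalSpectrum_eq κ L K']
  refine (finsum_eq_of_bijective _ (map_bijective κ K' F L h0) fun 𝔪 => ?_).symm
  haveI := 𝔪.isMaximal
  rw [finrank_separableClosure_residueField_eq_quotient κ K' F L h0]
  exact (finrank_separableClosure_quotient_map_eq κ K' F L h0 𝔪.asIdeal).symm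

include h0 in
/-- Every split weight in the fibre is `≥ 1` (it is the `K'`-dimension of the nonzero finite extension `M/𝔪`).
[this work] -/
theorem one_le_finrank_separableClosure_residueField (p : PrimeSpectrum (K' ⊗[κ] F)) :
    1 ≤ Module.finrank K' (separableClosure K' p.asIdeal.ResidueField) := by
  obtain ⟨𝔪, h𝔪⟩ := (map_bijective κ K' F L h0).2 p
  subst h𝔪
  haveI := 𝔪.isMaximal
  have h1 := finrank_separableClosure_residueField_eq_quotient κ K' F L h0
    ⟨𝔪.asIdeal.map (Algebra.TensorProduct.map (AlgHom.id K' K') (IsScalarTower.toAlgHom κ L F)), (isMaximal_map κ K' F L h0 𝔪.asIdeal).isPrime⟩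
  have h2 := finrank_separableClosure_quotient_map_eq κ K' F L h0 𝔪.asIdeal
  rw [h1.trans h2]
  letI := Ideal.Quotient.field 𝔪.asIdeal
  haveI : Module.Finite κ ((K' ⊗[κ] L) ⧸ 𝔪.asIdeal) := inferInstance
  haveI : Module.Finite K' ((K' ⊗[κ] L) ⧸ 𝔪.asIdeal) := Module.Finite.of_restrictScalars_finite κ K' _
  exact Module.finrank_pos

end Sum

/-! ## Specialisation to the separable constant field `L = κ^s ∩ F` -/

section SepClosure

variable [Algebra.IsSeparable κ K'] [FiniteDimensional κ K'] [FiniteDimensional κ (separableClosure κ F)]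

/-- **BC-2 (algebra), final form: `Σ_{p ∈ Spec (K' ⊗_κ F)} [κ(p)^s : K'] = [κ^s ∩ F : κ]`** for `K'/κ` finite
separable and `[κ^s ∩ F : κ] < ∞` (`κ^s ∩ F = separableClosure κ F`, the separable constant field of `F`):
the split weights of the points of the fibre over `η` add up to the split weight of `η`. [this work] -/
theorem finsum_finrank_separableClosure_residueField_tensorProduct :
    ∑ᶠ p : PrimeSpectrum (K' ⊗[κ] F), Module.finrank K' (separableClosure K' p.asIdeal.ResidueField) =
      Module.finrank κ (separableClosure κ F) :=
  finsum_finrank_separableClosure_residueField_eq κ K' F (separableClosure κ F)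
    (separableClosure.separableClosure_eq_bot κ F)

/-- Every split weight in the fibre is `≥ 1`. [this work] -/
theorem one_le_finrank_separableClosure_residueField_tensorProduct (p : PrimeSpectrum (K' ⊗[κ] F)) :
    1 ≤ Module.finrank K' (separableClosure K' p.asIdeal.ResidueField) :=
  one_le_finrank_separableClosure_residueField κ K' F (separableClosure κ F)
    (separableClosure.separableClosure_eq_bot κ F) p

end SepClosure

end SplitFieldFibre

end Summit.ResolutionOfSingularities.ResolutionOfSingularities.Theorems.NoZeno.ExcCount

end
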